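import Mathlib
import Summits.Ventures.HodgeRepro2.T7SupportShrinkingFiniteSets

/-!
# Isolation through an invariant and a local congruence (support, seat p1)

The combinatorial core of «isolation by shrinking supports at one place»: an invariant `κ : Orb → F` into a field
with an absolute value `abv`, a distinguished `γ₀`, and supports `geomSupp N` on which `κ` is congruent to
`κ γ₀` to depth `N` — `abv (κ γ − κ γ₀) ≤ q⁻¹ ^ N` for `γ ∈ geomSupp N`, `q > 1`. Then every `γ` lying in EVERY
support has `κ γ = κ γ₀` (`kappa_eq_of_forall_mem`), hence equals `γ₀` as soon as `κ` separates (`eq_of_forall_mem`);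
with the supports finite and decreasing, they are eventually `⊆ {γ₀}` (`eventually_subset_singleton`), and a sum of
weights over them collapses to the `γ₀`-term (`eventually_sum_eq_single`, from `T7SupportShrinkingFiniteSets`).

Pure algebra/analysis over an abstract index type; nothing here is about any adelic group, double coset, orbital
integral, or period. Blind lane: Mathlib + the HodgeRepro2 prefix only; no sorry; axioms ⊆ {propext,
Classical.choice, Quot.sound}.
-/

namespace Summit.Ventures.HodgeRepro2.T7SupportIsolation

open Filter Topology T7SupportShrinkingFiniteSets

variable {Orb F : Type*} [Field F]

/-- **the invariant of a point in every support is the invariant of `γ₀`**: if `abv (κ γ − κ γ₀) ≤ q⁻¹ ^ N` on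
`geomSupp N` with `q > 1`, a `γ` in every `geomSupp N` has `κ γ = κ γ₀`. -/
theorem kappa_eq_of_forall_mem (κ : Orb → F) (γ₀ : Orb) (geomSupp : ℕ → Set Orb)
    (abv : AbsoluteValue F ℝ) (q : ℝ) (hq : 1 < q)
    (hcong : ∀ N γ, γ ∈ geomSupp N → abv (κ γ - κ γ₀) ≤ q⁻¹ ^ N)
    (γ : Orb) (hγ : ∀ N, γ ∈ geomSupp N) : κ γ = κ γ₀ := by
  have hq0 : (0 : ℝ) ≤ q⁻¹ := by positivity
  have hq1 : q⁻¹ < 1 := inv_lt_one_of_one_lt₀ hq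
  have hlim : Tendsto (fun N : ℕ => q⁻¹ ^ N) atTop (𝓝 0) :=
    tendsto_pow_atTop_nhds_zero_of_lt_one hq0 hq1
  have hle : abv (κ γ - κ γ₀) ≤ 0 :=
    ge_of_tendsto' hlim (fun N => hcong N γ (hγ N))
  have h0 : abv (κ γ - κ γ₀) = 0 := le_antisymm hle (abv.nonneg _)
  exact sub_eq_zero.1 (abv.eq_zero.1 h0)

/-- **isolation**: with `κ` separating `γ₀` (`κ γ = κ γ₀ → γ = γ₀`), a point in every support is `γ₀`. -/
theorem eq_of_forall_mem (κ : Orb → F) (γ₀ : Orb) (geomSupp : ℕ → Set Orb)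
    (abv : AbsoluteValue F ℝ) (q : ℝ) (hq : 1 < q)
    (hcong : ∀ N γ, γ ∈ geomSupp N → abv (κ γ - κ γ₀) ≤ q⁻¹ ^ N)
    (hsep : ∀ γ, κ γ = κ γ₀ → γ = γ₀)
    (γ : Orb) (hγ : ∀ N, γ ∈ geomSupp N) : γ = γ₀ :=
  hsep γ (kappa_eq_of_forall_mem κ γ₀ geomSupp abv q hq hcong γ hγ)

/-- **the supports are eventually `⊆ {γ₀}`** when they are finite and decreasing. -/
theorem eventually_subset_singleton (κ : Orb → F) (γ₀ : Orb) (geomSupp : ℕ → Set Orb)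
    (hanti : Antitone geomSupp) (hfin : (geomSupp 0).Finite)
    (abv : AbsoluteValue F ℝ) (q : ℝ) (hq : 1 < q)
    (hcong : ∀ N γ, γ ∈ geomSupp N → abv (κ γ - κ γ₀) ≤ q⁻¹ ^ N)
    (hsep : ∀ γ, κ γ = κ γ₀ → γ = γ₀) :
    ∃ N₀, ∀ N ≥ N₀, geomSupp N ⊆ {γ₀} := by
  refine eventually_subset_of_antitone_finite geomSupp hanti hfin {γ₀} ?_
  intro γ hγ
  rw [Set.mem_iInter] at hγ
  exact eq_of_forall_mem κ γ₀ geomSupp abv q hq hcong hsep γ hγ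

/-- **the geometric side collapses**: finsets `Γ N` decreasing, `γ₀ ∈ Γ N` for all `N`, the congruence and the
separation ⇒ `∑ γ ∈ Γ N, w N γ = w N γ₀` for `N` large (any additive commutative monoid of weights). -/
theorem eventually_sum_eq_single_of_kappa {M : Type*} [AddCommMonoid M] (κ : Orb → F) (γ₀ : Orb)
    (Γ : ℕ → Finset Orb) (hanti : ∀ N, Γ (N + 1) ⊆ Γ N) (hγ₀ : ∀ N, γ₀ ∈ Γ N)
    (abv : AbsoluteValue F ℝ) (q : ℝ) (hq : 1 < q)
    (hcong : ∀ N γ, γ ∈ Γ N → abv (κ γ - κ γ₀) ≤ q⁻¹ ^ N)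
    (hsep : ∀ γ, κ γ = κ γ₀ → γ = γ₀) (w : ℕ → Orb → M) :
    ∃ N₀, ∀ N ≥ N₀, ∑ γ ∈ Γ N, w N γ = w N γ₀ := by
  refine eventually_sum_eq_single Γ hanti γ₀ hγ₀ ?_ w
  intro γ hγ
  rw [Set.mem_iInter] at hγ
  exact eq_of_forall_mem κ γ₀ (fun N => (Γ N : Set Orb)) abv q hq
    (fun N γ h => hcong N γ (by exact_mod_cast h)) hsep γ hγ

end Summit.Ventures.HodgeRepro2.T7SupportIsolation
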